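import Mathlib
import Summits.Schanuel.Schanuel.Theses.RigidCore
import Summits.Schanuel.Schanuel.Theorems.RigidCoreDefs
import Summits.Schanuel.Schanuel.Theorems.RigidCoreSchanuelOnLogFreeCoreHorizontalSplit
import Literature.NumberTheory.Transcendental.GammaFields
import Literature.NumberTheory.Transcendental.GammaFieldsEcl
import Literature.NumberTheory.Transcendental.GammaStrongDescent
import Literature.NumberTheory.Transcendental.ZilberFieldHomogeneity

/-!
# Line `generic-period-fibre` (route `RigidCore`): the horizontal split of the crux is exact

Prover file for the registered stub `stub_splitExact` (S1) of line `generic-period-fibre` of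
crux `stmt-Schanuel-0970` (`Summit.Schanuel.Schanuel.Theses.RigidCore.SchanuelOnLogFreeCore`,
"(R)": Schanuel's statement for `ℚ`-linearly independent tuples from the log-free core
`C_EA = sInf {K | 2πi ∈ K, K exp-closed, K relatively algebraically closed in ℂ}` = `eaFibre (2πi)`):

  **`(R) ⟺ A ∧ B`**, where, with `M = kernelFreeCore = sInf {K | K exp-closed, K r.a.c.} ≤ C_EA`
  the kernel-free core (file `RigidCoreDefs`; both `sInf`s are inlined verbatim in the signature),
* `A` = Schanuel's statement for `ℚ`-linearly independent tuples from `M`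
  (stub `stub_schanuelOnKernelFreeCore`, open), and
* `B` = RELATIVE Schanuel of `C_EA` over `M`: tuples from `C_EA` that are `ℚ`-linearly independent
  modulo `M` have `n ≤ trdeg_M M(x, eˣ)` (stub `stub_periodGenericOverCore`, open).
So the line's split loses nothing: a refutation of `A` or of `B` refutes (R).

Proof.
* `⇐` is the landed horizontal split `stub_horizontalSplit` (file
  `RigidCoreSchanuelOnLogFreeCoreHorizontalSplit.lean`; J. Kirby, *Exponential algebraicity in
  exponential fields*, Bull. LMS 42 (2010), arXiv:0810.4285, Prop. 7.2 with `ℚ(ecl ∅) ↦ M`) at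
  `M ≤ C_EA` (`M` is `exp`-closed, `exp_mem_kernelFreeCore`).
* `(R) ⟹ A` (`SplitExact.stubA_of_crux`): restriction along `M ≤ C_EA`.
* `(R) ⟹ B` (`SplitExact.stubB_of_crux`): a HULL COUNT in the predimension calculus of Γ-fields
  (`Literature.NumberTheory.Transcendental.GammaField`: `δ = predim = td - ldim`, `gens`, `acl`,
  `algMatroid`; M. Bays, J. Kirby, *Pseudo-exponential maps, variants, and quasiminimality*,
  Algebra & Number Theory 12 (2018), arXiv:1512.04262, §9; Kirby 2010, §3):
  - (R) gives `δ(X/0) ≥ 0` for every finitely generated `ℚ`-subspace `X ≤ C_EA` (evaluate (R) at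
    a basis of `X`; `SplitExact.predim_bot_nonneg`), so the `δ = 0` subspaces of `C_EA` are closed
    under `+` (addition formula and submodularity; `SplitExact.predim_bot_sup_eq_zero`);
  - every `a ∈ M` is algebraic over the Γ-field `ℚ(V, e^V)` of a finitely generated HULL `V ≤ M`
    with `δ(V/0) = 0` (`SplitExact.exists_hull_of_mem_kernelFreeCore`): the elements of `M` with a
    hull form an intermediate field that is `exp`-closed (one new exponential over an algebraic
    point has `td ≤ 1 = ldim`, so `δ ≤ 0`, and `δ ≥ 0` by (R); `SplitExact.exists_hull_exp`) and
    relatively algebraically closed (finite character of algebraic dependence and common hulls,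
    `SplitExact.exists_common_hull`) — built inside the proof, no definition is introduced —
    hence it contains the `sInf` `M`;
  - for `x ⊂ C_EA` independent modulo `M`, finite character of the algebraic matroid gives a finite
    `c ⊂ M` such that `relRank(x ∪ eˣ / M) = trdeg_M M(x, eˣ)` (`toENat_trdeg_adjoin_eq_relRank`)
    is still the relative rank over `J ∪ c` for an `M`-basis `J` of `x ∪ eˣ`; with `V` a hull of `c`:
    `n = ldim(x/M) ≤ ldim(x/V) ≤ td(x/V) ≤ relRank(x ∪ eˣ / gens V) ≤ relRank(x ∪ eˣ / M)`.

Adapted from the refuter's kernel-checked certificate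
`Summits/Schanuel/Schanuel/Cruxes/SchanuelOnLogFreeCore/SplitExact.lean` (drefute, namespace
`DrefuteGPF`, `crux_iff_stubA_and_stubB`).  This file closes nothing by itself (`A` and `B` are the
open residue of the crux); it is the landed form of the line's glue `(R) ⟺ A ∧ B`.
-/
noncomputable section

namespace Summit.Schanuel.Schanuel.Theorems.RigidCore

open Set Literature.NumberTheory.Transcendental Literature.NumberTheory.Transcendental.GammaField
open Summit.Schanuel.Schanuel.Theses.RigidCore (SchanuelOnLogFreeCore)

namespace SplitExact

/-- `M ≤ C_EA` for the `ℚ`-subspaces underlying the two cores. -/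
theorem toSubmodule_kernelFreeCore_le :
    Subalgebra.toSubmodule kernelFreeCore.toSubalgebra ≤
      Subalgebra.toSubmodule (eaFibre (2 * ↑Real.pi * Complex.I)).toSubalgebra :=
  fun _ h => kernelFreeCore_le_eaFibre _ h

/-! ## (R) ⟹ `δ ≥ 0` over `0` inside `C_EA`, and `δ = 0` is closed under sums -/

/-- (R) gives `0 ≤ δ(X/0) = td(X/0) - ldim(X/0)` for every finitely generated `ℚ`-subspace `X`
of `C_EA`: evaluate (R) at a basis of `X` (cf. `ZilberHomogeneity.isStrong_bot_of_schanuelProperty`). -/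
theorem predim_bot_nonneg (hR : SchanuelOnLogFreeCore) {X : Submodule ℚ ℂ}
    (hXC : X ≤ Subalgebra.toSubmodule (eaFibre (2 * ↑Real.pi * Complex.I)).toSubalgebra)
    (hfg : IsFG (⊥ : Submodule ℚ ℂ) X) : 0 ≤ predim ⊥ X := by
  have hinj : Function.Injective (⊥ : Submodule ℚ ℂ).mkQ := LinearMap.ker_eq_bot.1 (Submodule.ker_mkQ _)
  haveI : Module.Finite ℚ X := Module.Finite.iff_fg.2 (Submodule.fg_of_fg_map_injective _ hinj hfg)
  let b := Module.finBasis ℚ X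
  have hn : ldim (⊥ : Submodule ℚ ℂ) X = Module.finrank ℚ X :=
    (Submodule.equivMapOfInjective _ hinj X).finrank_eq.symm
  have hx : LinearIndependent ℚ (fun i => (b i : ℂ)) :=
    b.linearIndependent.map' X.subtype X.ker_subtype
  have h1 := ZilberHomogeneity.natCast_le_eRk_of_le_trdeg
    (hR (Module.finrank ℚ X) (fun i => (b i : ℂ)) (fun i => hXC (b i).2) hx)
  have h2 : (algMatroid ℂ).eRk (range (fun i => (b i : ℂ)) ∪ range (Complex.exp ∘ fun i => (b i : ℂ)))
      ≤ td ⊥ X := by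
    rw [ZilberHomogeneity.td_bot]
    refine (algMatroid ℂ).eRk_mono ?_
    rintro a (⟨i, rfl⟩ | ⟨i, rfl⟩)
    exacts [mem_gens_of_mem (b i).2, exp_mem_gens (b i).2]
  have h3 := h1.trans h2
  rw [← ENat.coe_toNat (td_ne_top hfg), ENat.coe_le_coe] at h3
  rw [predim_def, hn]
  omega

/-- Sums of `δ = 0` finitely generated subspaces of `C_EA` have `δ = 0` (addition formula,
submodularity `δ(W/V) ≤ δ(W/W ∩ V)`, and `δ ≥ 0` from (R)). -/
theorem predim_bot_sup_eq_zero (hR : SchanuelOnLogFreeCore) {V W : Submodule ℚ ℂ}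
    (hVC : V ≤ Subalgebra.toSubmodule (eaFibre (2 * ↑Real.pi * Complex.I)).toSubalgebra)
    (hWC : W ≤ Subalgebra.toSubmodule (eaFibre (2 * ↑Real.pi * Complex.I)).toSubalgebra)
    (hVfg : IsFG (⊥ : Submodule ℚ ℂ) V) (hWfg : IsFG (⊥ : Submodule ℚ ℂ) W)
    (hV0 : predim ⊥ V = 0) (hW0 : predim ⊥ W = 0) : predim ⊥ (V ⊔ W) = 0 := by
  have hge := predim_bot_nonneg hR (sup_le hVC hWC) (hVfg.sup hWfg)
  have hadd := predim_add bot_le (le_sup_left : V ≤ V ⊔ W) (hVfg.sup hWfg)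
  rw [predim_sup_left] at hadd
  have hsub : predim V W ≤ predim (W ⊓ V) W := by
    simpa only [predim_sup_right] using predim_sup_le W V (hWfg.of_le_left bot_le)
  have hadd2 := predim_add bot_le (inf_le_left : W ⊓ V ≤ W) hWfg
  have hinf : 0 ≤ predim ⊥ (W ⊓ V) :=
    predim_bot_nonneg hR (inf_le_left.trans hWC) (hWfg.mono inf_le_left)
  linarith

/-! ## Hulls inside `M`

A HULL of `a` is a finitely generated `ℚ`-subspace `V ≤ M` with `δ(V/0) = 0` over whose Γ-field
`ℚ(V, exp V)` the number `a` is algebraic, `a ∈ acl (gens V)`; the condition is always written out. -/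

/-- Hulls inside `M` are `exp`-closed: for `a ∈ M` with hull `V`, `V + ℚa ≤ M` has `δ = 0` (`td(a, eᵃ/V) ≤ 1 = ldim`
gives `δ(ℚa/V) ≤ 0`, (R) gives `≥ 0`), and `eᵃ` is a generator of its Γ-field. -/
theorem exists_hull_exp (hR : SchanuelOnLogFreeCore) {a : ℂ} (haM : a ∈ kernelFreeCore)
    (ha : ∃ V : Submodule ℚ ℂ, V ≤ Subalgebra.toSubmodule kernelFreeCore.toSubalgebra ∧
      IsFG (⊥ : Submodule ℚ ℂ) V ∧ predim ⊥ V = 0 ∧ a ∈ acl (gens V)) :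
    ∃ V : Submodule ℚ ℂ, V ≤ Subalgebra.toSubmodule kernelFreeCore.toSubalgebra ∧
      IsFG (⊥ : Submodule ℚ ℂ) V ∧ predim ⊥ V = 0 ∧ Complex.exp a ∈ acl (gens V) := by
  obtain ⟨V, hV, hVfg, hV0, haV⟩ := ha
  have hV'M : V ⊔ Submodule.span ℚ {a} ≤ Subalgebra.toSubmodule kernelFreeCore.toSubalgebra :=
    sup_le hV ((Submodule.span_singleton_le_iff_mem _ _).2 haM)
  have hV'fg : IsFG (⊥ : Submodule ℚ ℂ) (V ⊔ Submodule.span ℚ {a}) :=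
    hVfg.sup (isFG_span_of_finite ⊥ (finite_singleton a))
  have htd : td V (Submodule.span ℚ {a}) ≤ 1 := by
    rw [td_span_singleton, (algMatroid ℂ).relRank_insert_eq_of_mem_closure
      ((algMatroid ℂ).closure_subset_closure subset_union_right haV)]
    exact ((algMatroid ℂ).relRank_le_encard_diff _ _).trans
      ((encard_le_encard sdiff_subset).trans (encard_singleton _).le)
  have hge := predim_bot_nonneg hR (hV'M.trans toSubmodule_kernelFreeCore_le) hV'fg
  rw [predim_add bot_le le_sup_left hV'fg, predim_sup_left, hV0, zero_add] at hge
  refine ⟨_, hV'M, hV'fg, ?_, subset_acl _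
    (exp_mem_gens (Submodule.mem_sup_right (Submodule.mem_span_singleton_self a)))⟩
  rw [predim_add bot_le le_sup_left hV'fg, predim_sup_left, hV0, zero_add]
  exact le_antisymm (predim_span_singleton_nonpos_of_td_le_one htd) hge

/-- A finite set of elements with hulls has a common hull (sum of the hulls, `δ = 0` by
`predim_bot_sup_eq_zero`). -/
theorem exists_common_hull (hR : SchanuelOnLogFreeCore) {s : Set ℂ} (hs : s.Finite)
    (hsub : ∀ c ∈ s, ∃ V : Submodule ℚ ℂ, V ≤ Subalgebra.toSubmodule kernelFreeCore.toSubalgebra ∧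
      IsFG (⊥ : Submodule ℚ ℂ) V ∧ predim ⊥ V = 0 ∧ c ∈ acl (gens V)) :
    ∃ V : Submodule ℚ ℂ, V ≤ Subalgebra.toSubmodule kernelFreeCore.toSubalgebra ∧
      IsFG (⊥ : Submodule ℚ ℂ) V ∧ predim ⊥ V = 0 ∧ s ⊆ acl (gens V) := by
  induction s, hs using Set.Finite.induction_on with
  | empty => exact ⟨⊥, bot_le, isFG_self ⊥, predim_self ⊥, empty_subset _⟩
  | insert _ _ ih =>
    obtain ⟨W, hW, hWfg, hW0, hsW⟩ := ih fun c hc => hsub c (mem_insert_of_mem _ hc)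
    obtain ⟨V, hV, hVfg, hV0, haV⟩ := hsub _ (mem_insert _ _)
    exact ⟨V ⊔ W, sup_le hV hW, hVfg.sup hWfg,
      predim_bot_sup_eq_zero hR (hV.trans toSubmodule_kernelFreeCore_le)
        (hW.trans toSubmodule_kernelFreeCore_le) hVfg hWfg hV0 hW0,
      insert_subset (acl_mono (gens_mono le_sup_left) haV)
        (hsW.trans (acl_mono (gens_mono le_sup_right)))⟩

/-- **Every element of the kernel-free core `M` has a hull inside `M`.**  The elements of `M`
with a hull form an intermediate field `H` (common hulls give `+`, `×`), `exp`-closed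
(`exists_hull_exp`) and relatively algebraically closed (an element algebraic over `H` lies in the
r.a.c. `M` and is algebraic over finitely many elements of `H`, which have a common hull); hence
`M = sInf {…} ≤ H`.  `H` is built inside the proof; no definition is introduced. -/
theorem exists_hull_of_mem_kernelFreeCore (hR : SchanuelOnLogFreeCore) {a : ℂ}
    (ha : a ∈ kernelFreeCore) :
    ∃ V : Submodule ℚ ℂ, V ≤ Subalgebra.toSubmodule kernelFreeCore.toSubalgebra ∧
      IsFG (⊥ : Submodule ℚ ℂ) V ∧ predim ⊥ V = 0 ∧ a ∈ acl (gens V) := by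
  let H : IntermediateField ℚ ℂ :=
    { carrier := {a | a ∈ kernelFreeCore ∧
        ∃ V : Submodule ℚ ℂ, V ≤ Subalgebra.toSubmodule kernelFreeCore.toSubalgebra ∧
          IsFG (⊥ : Submodule ℚ ℂ) V ∧ predim ⊥ V = 0 ∧ a ∈ acl (gens V)}
      mul_mem' := fun {a b} ha hb => ⟨mul_mem ha.1 hb.1, by
        obtain ⟨V, hV, hVfg, hV0, hs⟩ := exists_common_hull hR (toFinite {a, b})
          (by rintro c (rfl | hc); exacts [ha.2, mem_singleton_iff.1 hc ▸ hb.2])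
        exact ⟨V, hV, hVfg, hV0,
          mul_mem_acl (hs (mem_insert _ _)) (hs (mem_insert_of_mem _ (mem_singleton _)))⟩⟩
      one_mem' := ⟨one_mem _, ⊥, bot_le, isFG_self ⊥, predim_self ⊥, one_mem_acl _⟩
      add_mem' := fun {a b} ha hb => ⟨add_mem ha.1 hb.1, by
        obtain ⟨V, hV, hVfg, hV0, hs⟩ := exists_common_hull hR (toFinite {a, b})
          (by rintro c (rfl | hc); exacts [ha.2, mem_singleton_iff.1 hc ▸ hb.2])
        exact ⟨V, hV, hVfg, hV0,
          add_mem_acl (hs (mem_insert _ _)) (hs (mem_insert_of_mem _ (mem_singleton _)))⟩⟩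
      zero_mem' := ⟨zero_mem _, ⊥, bot_le, isFG_self ⊥, predim_self ⊥, zero_mem_acl _⟩
      algebraMap_mem' := fun q =>
        ⟨algebraMap_mem _ q, ⊥, bot_le, isFG_self ⊥, predim_self ⊥, algebraMap_mem_acl q⟩
      inv_mem' := fun _ ha => ⟨inv_mem ha.1, by
        obtain ⟨V, hV, hVfg, hV0, haV⟩ := ha.2
        exact ⟨V, hV, hVfg, hV0, inv_mem_acl haV⟩⟩ }
  have hHM : H ≤ kernelFreeCore := fun _ ha => ha.1
  -- `H` is `exp`-closed and relatively algebraically closed, hence contains `M = sInf {…}`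
  suffices hrac : ∀ w : ℂ, IsAlgebraic H w → w ∈ H from
    (kernelFreeCore_le (K := H)
      (fun w hw => ⟨exp_mem_kernelFreeCore hw.1, exists_hull_exp hR hw.1 hw.2⟩) hrac ha).2
  intro w hw
  have hwM : w ∈ kernelFreeCore := by
    letI : Algebra H kernelFreeCore := (IntermediateField.inclusion hHM).toRingHom.toAlgebra
    haveI : IsScalarTower H kernelFreeCore ℂ := IsScalarTower.of_algebraMap_eq (fun _ => rfl)
    exact mem_kernelFreeCore_of_isAlgebraic (hw.tower_top kernelFreeCore)
  have hw' : w ∈ acl ((H : IntermediateField ℚ ℂ) : Set ℂ) := by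
    rw [mem_acl_iff, ← IntermediateField.coe_toSubalgebra, Algebra.adjoin_eq]
    exact hw
  obtain ⟨I, hIH, hIfin, -, hwI⟩ := (algMatroid ℂ).exists_mem_finite_closure_of_mem_closure hw'
  obtain ⟨V, hV, hVfg, hV0, hIV⟩ := exists_common_hull hR hIfin (fun c hc => (hIH hc).2)
  exact ⟨hwM, V, hV, hVfg, hV0, acl_subset_acl_of_subset hIV hwI⟩

/-! ## `(R) ⟹ B`, `(R) ⟹ A`, and the registered stub -/

/-- **`(R) ⟹ B`**: Schanuel on the log-free core `C_EA` implies relative Schanuel of `C_EA` over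
the kernel-free core `M`: for `x ⊂ C_EA` independent modulo `M` and a hull `V ≤ M` of the finitely
many elements of `M` carrying the relative rank of `x ∪ eˣ` over `M` (finite character),
`n = ldim(x/M) ≤ ldim(x/V) ≤ td(x/V) ≤ relRank(x ∪ eˣ / M) = trdeg_M M(x, eˣ)`. -/
theorem stubB_of_crux (hR : SchanuelOnLogFreeCore) (n : ℕ) (x : Fin n → ℂ)
    (hxC : ∀ i, x i ∈ eaFibre (2 * ↑Real.pi * Complex.I))
    (hli : LinearIndependent ℚ ((Submodule.span ℚ (kernelFreeCore : Set ℂ)).mkQ ∘ x)) :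
    (n : Cardinal) ≤ Algebra.trdeg kernelFreeCore
      ↥(IntermediateField.adjoin kernelFreeCore (range x ∪ range (Complex.exp ∘ x))) := by
  set S : Set ℂ := range x ∪ range (Complex.exp ∘ x)
  set X : Submodule ℚ ℂ := Submodule.span ℚ (range x) with hX
  have hSfin : S.Finite := (finite_range x).union (finite_range _)
  -- (1) finite character: a basis `J` of `S` over `M` and a finite `I ⊆ J ∪ M` spanning `S`
  obtain ⟨J, hJ⟩ := ((algMatroid ℂ).contract (kernelFreeCore : Set ℂ)).exists_isBasis' S
  have hρ : (algMatroid ℂ).relRank (kernelFreeCore : Set ℂ) S = J.encard := by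
    rw [Matroid.relRank_eq_eRk_contract, hJ.encard_eq_eRk]
  have hSclJ : S ⊆ (algMatroid ℂ).closure (J ∪ (kernelFreeCore : Set ℂ)) := fun a haS => by
    by_cases haM : a ∈ (kernelFreeCore : Set ℂ)
    · exact (algMatroid ℂ).subset_closure _ (fun _ _ => mem_univ _) (Or.inr haM)
    · have haE : a ∈ ((algMatroid ℂ).contract (kernelFreeCore : Set ℂ)).E := by
        rw [Matroid.contract_ground]; exact ⟨mem_univ a, haM⟩
      have h1 := ((algMatroid ℂ).contract (kernelFreeCore : Set ℂ)).inter_ground_subset_closure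
        S ⟨haS, haE⟩
      rw [← hJ.closure_eq_closure, Matroid.contract_closure_eq] at h1
      exact h1.1
  obtain ⟨I, hIJM, hIfin, -, hSI⟩ :=
    (algMatroid ℂ).exists_subset_finite_closure_of_subset_closure hSfin hSclJ
  -- (2) a hull `V` of the finitely many elements of `M` in `I`
  obtain ⟨V, hV, hVfg, hV0, hcV⟩ := exists_common_hull hR (hIfin.inter_of_left (kernelFreeCore : Set ℂ))
    fun a ha => exists_hull_of_mem_kernelFreeCore hR ha.2
  -- (3) over `gens V` the set `S` still has relative rank `≤ |J| = relRank (S / M)`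
  have hle1 : (algMatroid ℂ).relRank (gens V) S ≤ J.encard := by
    have hScl : S ⊆ (algMatroid ℂ).closure (J ∪ gens V) := by
      refine hSI.trans ((algMatroid ℂ).closure_subset_closure_of_subset_closure fun a ha => ?_)
      rcases hIJM ha with haJ | haM
      · exact (algMatroid ℂ).subset_closure (J ∪ gens V) (fun _ _ => mem_univ _) (Or.inl haJ)
      · exact (algMatroid ℂ).closure_subset_closure subset_union_right (hcV ⟨ha, haM⟩)
    calc (algMatroid ℂ).relRank (gens V) S ≤ (algMatroid ℂ).relRank (gens V) J :=
          (algMatroid ℂ).relRank_le_of_subset_closure _ hScl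
      _ ≤ (J \ gens V).encard := (algMatroid ℂ).relRank_le_encard_diff _ _
      _ ≤ J.encard := encard_le_encard sdiff_subset
  -- (4) `td(X/V) ≤ relRank (S / gens V)`; (5) `δ(X/V) ≥ 0`; (6) `ldim(X/V) ≥ ldim(X/M) = n`
  have htdle : td V X ≤ (algMatroid ℂ).relRank (gens V) S := by
    have h := td_span_le_relRank V (range x)
    rw [← range_comp] at h
    exact h
  have hXC : X ≤ Subalgebra.toSubmodule (eaFibre (2 * ↑Real.pi * Complex.I)).toSubalgebra :=
    Submodule.span_le.2 (range_subset_iff.2 fun i => hxC i)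
  have hXfg : IsFG (⊥ : Submodule ℚ ℂ) X := isFG_span_of_finite ⊥ (finite_range x)
  have hVXfg : IsFG (⊥ : Submodule ℚ ℂ) (V ⊔ X) := hVfg.sup hXfg
  have hpVX := predim_bot_nonneg hR (sup_le (hV.trans toSubmodule_kernelFreeCore_le) hXC) hVXfg
  rw [predim_add bot_le le_sup_left hVXfg, predim_sup_left, hV0, zero_add, predim_def] at hpVX
  have hldimM : ldim (Submodule.span ℚ (kernelFreeCore : Set ℂ)) X = n := by
    rw [ldim, hX, Submodule.map_span, ← range_comp, finrank_span_eq_card hli, Fintype.card_fin]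
  have hldim : n ≤ ldim V X := by
    have hVM : V ≤ Submodule.span ℚ (kernelFreeCore : Set ℂ) :=
      fun v hv => Submodule.subset_span (hV hv)
    have h := ldim_add (inf_le_inf_left X hVM) inf_le_left (hXfg.of_le_left bot_le)
    rw [← ldim_eq_ldim_inf X V, ← ldim_eq_ldim_inf X, hldimM] at h
    omega
  -- (7) `n ≤ ldim(X/V) ≤ td(X/V) ≤ relRank (S / gens V) ≤ relRank (S / M) = trdeg_M M(S)`
  refine Cardinal.natCast_le_toENat.1 ?_
  rw [toENat_trdeg_adjoin_eq_relRank kernelFreeCore S, hρ]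
  calc (n : ℕ∞) ≤ ((td V X).toNat : ℕ∞) := ENat.coe_le_coe.2 (by omega)
    _ = td V X := ENat.coe_toNat (td_ne_top (hXfg.of_le_left bot_le))
    _ ≤ J.encard := htdle.trans hle1

/-- **`(R) ⟹ A`**: restriction along `M ≤ C_EA`. -/
theorem stubA_of_crux (hR : SchanuelOnLogFreeCore) (n : ℕ) (x : Fin n → ℂ)
    (hx : ∀ i, x i ∈ kernelFreeCore) (hli : LinearIndependent ℚ x) :
    (n : Cardinal) ≤ Algebra.trdeg ℚ
      ↥(IntermediateField.adjoin ℚ (range x ∪ range (Complex.exp ∘ x))) := by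
  have hx' : ∀ i, x i ∈ eaFibre (2 * ↑Real.pi * Complex.I) :=
    fun i => kernelFreeCore_le_eaFibre _ (hx i)
  exact hR n x hx' hli

end SplitExact

/-- **Registered stub `stub_splitExact` (S1) of line `generic-period-fibre` — the split is exact:
`(R) ⟺ A ∧ B`** (signature verbatim): Schanuel's statement for `ℚ`-linearly independent tuples
from the log-free core `C_EA` is EQUIVALENT to (`A`) Schanuel's statement for such tuples from the
kernel-free core `M = sInf {K | K exp-closed, K r.a.c.}` together with (`B`) relative Schanuel of
`C_EA` over `M`.  `⇒`: `SplitExact.stubA_of_crux`, `SplitExact.stubB_of_crux` (hull count);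
`⇐`: the landed `stub_horizontalSplit` at `M ≤ C_EA`.  The `sInf`s are `kernelFreeCore` and
`eaFibre (2πi)` (`RigidCoreDefs`) by `rfl`. -/
theorem stub_splitExact :
    Summit.Schanuel.Schanuel.Theses.RigidCore.SchanuelOnLogFreeCore ↔
    ((∀ (n : ℕ) (x : Fin n → ℂ),
      (∀ i, x i ∈ (sInf {K : IntermediateField ℚ ℂ | (∀ w ∈ K, Complex.exp w ∈ K) ∧
        ∀ w : ℂ, IsAlgebraic K w → w ∈ K} : IntermediateField ℚ ℂ)) →
      LinearIndependent ℚ x →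
        (n : Cardinal) ≤ Algebra.trdeg ℚ
          ↥(IntermediateField.adjoin ℚ (Set.range x ∪ Set.range (Complex.exp ∘ x)))) ∧
     (∀ (n : ℕ) (x : Fin n → ℂ),
      (∀ i, x i ∈ (sInf {K : IntermediateField ℚ ℂ | (2 * ↑Real.pi * Complex.I : ℂ) ∈ K ∧
        (∀ w ∈ K, Complex.exp w ∈ K) ∧ ∀ w : ℂ, IsAlgebraic K w → w ∈ K} : IntermediateField ℚ ℂ)) →
      LinearIndependent ℚ ((Submodule.span ℚ ((sInf {K : IntermediateField ℚ ℂ |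
        (∀ w ∈ K, Complex.exp w ∈ K) ∧ ∀ w : ℂ, IsAlgebraic K w → w ∈ K} :
          IntermediateField ℚ ℂ) : Set ℂ)).mkQ ∘ x) →
        (n : Cardinal) ≤ Algebra.trdeg
          ↥(sInf {K : IntermediateField ℚ ℂ | (∀ w ∈ K, Complex.exp w ∈ K) ∧
            ∀ w : ℂ, IsAlgebraic K w → w ∈ K} : IntermediateField ℚ ℂ)
          ↥(IntermediateField.adjoin
            ↥(sInf {K : IntermediateField ℚ ℂ | (∀ w ∈ K, Complex.exp w ∈ K) ∧
              ∀ w : ℂ, IsAlgebraic K w → w ∈ K} : IntermediateField ℚ ℂ)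
            (Set.range x ∪ Set.range (Complex.exp ∘ x))))) := by
  exact ⟨fun h => ⟨SplitExact.stubA_of_crux h, SplitExact.stubB_of_crux h⟩,
    fun h => stub_horizontalSplit _ _ (fun _ hw => exp_mem_kernelFreeCore hw) h.1 h.2⟩

end Summit.Schanuel.Schanuel.Theorems.RigidCore

end
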